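import Summits.ResolutionOfSingularities.ResolutionOfSingularities.Theorems.TameTwoStoreyLU1B
import HarnessLib

/-!
# TameTwoStoreyLU (2/4) — the cell `TameOverInertLUAbove`, Galois generation by a separator, transport to the base

Part 2 of the g29 node «TameTwoStorey» of the ROOT/RESIDUAL decomposition cell `decomp-res` (lens 1, window (W-α)
WHOLE); see the module docstring of `Summits.ResolutionOfSingularities.ResolutionOfSingularities.Theorems.TameTwoStoreyLU` (part 1/4) for the thesis, the cell
`TameOverInertLUAbove k O`, the law `relLU_of_tameOverInertLUAbove : TameOverInertLUAbove k O → RelLocalUniformization k K O`,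
the paper instances and the sources.  This part: PART B1 — the cell ((A1)–(A3), inertia predicate inline, `z`-enriched model clause), `exists_aeval_eq_of_fixed`, `relLU_transport`.
Problem side, sorry-free, hypothesis-free.
-/

noncomputable section

open IsLocalRing Polynomial IntermediateField Literature.AlgebraicGeometry.Resolution
open Summit.ResolutionOfSingularities.ResolutionOfSingularities.Theorems.TameQuotientLU
open Summit.ResolutionOfSingularities.ResolutionOfSingularities.Theorems.TameAbelianQuotientLU
open Summit.ResolutionOfSingularities.ResolutionOfSingularities.Theorems.InertiaIsotypicStability
open Summit.ResolutionOfSingularities.ResolutionOfSingularities.Theorems.TameInertialLU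
open Summit.ResolutionOfSingularities.ResolutionOfSingularities.Theorems.TameAbelianMonomialChart

namespace Summit.ResolutionOfSingularities.ResolutionOfSingularities.Theorems.TameTwoStoreyLU

universe u

section Law

variable (k : Type) [Field k] {K : Type} [Field K] [Algebra k K]

/-- **THE TWO-STOREY TAME CELL `(A1)–(A3)`** («TameTwoStorey», window (W-α) WHOLE; PRE-RULINGs decomp-res-crit-1
STATUS :1914 (C2)(ii) / :1951, letter rows 213/215/216a/218b/219c).  A FINITE GALOIS TOP `K ⊆ K′` (inside a fixed
algebraic closure), a valuation ring `O′` of `K′` above `O`, and: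
* (A1) `O′` is `G`-STABLE for the WHOLE Galois group `G = Gal(K′/K)` (one prime of `K′` above `O`: `G = G_Z`; the SPLIT
  storey `K ⊊ K_Z` is henselisation-input production = Door B, (α3) of the honest remainder);
* (A2) the INERTIA GROUP `T = G_T := {g | ∀ y ∈ O′, v′(g y − y) < 1}` (written INLINE, no auxiliary predicate) is
  ABELIAN of exponent dividing `e`, with `0 < e`, `(e : k) ≠ 0` and a primitive `e`-th root of unity `ζ ∈ K′` — the
  TAME storey `K_T ⊆ K′`; the INERT storey `K ⊆ K_T = K′^T` is an ARBITRARY Galois extension (`H = G/T` arbitrary: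
  NO complement, NO «residues in `k`», NO «`μ_e ⊆ k`/`μ_e ⊆ K`», NO cyclotomic-compatibility clause (A8));
* (A3) the residues of `O′` are ALGEBRAIC over `k` (`∀ y ∈ O′, ∃ f ∈ k[X] ∖ 0, f(y) ∈ 𝔪′`);
* MODEL CLAUSE = `G`-EQUIVARIANT RELATIVE LOCAL UNIFORMIZATION UPSTAIRS in the tree's g25 currency
  `TameQuotientLU.modelAbove`: for every finitely generated birational model `R ⊆ O` of `K | k` and every finite
  `G`-stable set `z ⊆ O′` there is a `G`-STABLE model `R[t₀] ⊆ O′` of `K′` containing `z` whose local ring at the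
  centre of `O′` is regular (implied by `G`-equivariant LU of `(K′, O′)` applied to the `G`-stable model `R[z]`).
Compared with g26's `TameAbelianQuotientLU.TameAbelianEquivariantLUAbove` (cell of the abelian-quotient node): `G`
abelian ↦ only `T` abelian; `g ^ ℓ = 1` on `G` ↦ on `T`; `ζ : k` ↦ `ζ : K′`; «residues in `k`» ↦ (A3); model clause
enriched by the finite `G`-stable set `z`.  Inhabitants (paper instances, NODE-g29.md §4): the Kummer–`S₃` top
`K′ = K(ζ₃, ∛u)`, `p ≡ 2 (mod 3)` (`T = C₃`, `H = C₂` acting by inversion), and the NON-SPLIT quaternion top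
`G = Q₈ ⊋ T = C₄`, `H = C₂`, `e = 4`, residue characteristic `≡ 3 (mod 4)` (`H²(H,T) ≠ 0`: no complement exists).
(Sources: CossartPiltant2008, Lemma 9.4; CossartPiltant2019, Prop. 4.10; Kuhlmann2000, Sections 13-15; ZariskiSamuel1975 VI
Section 12.) -/
def TameOverInertLUAbove (O : ValuationSubring K) : Prop :=
  ∃ K' : IntermediateField K (AlgebraicClosure K), FiniteDimensional K K' ∧ IsGalois K K' ∧
  ∃ e : ℕ, 0 < e ∧ (e : k) ≠ 0 ∧
  ∃ ζ : K', IsPrimitiveRoot ζ e ∧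
  ∃ O' : ValuationSubring K', O'.comap (algebraMap K K') = O ∧
    (∀ g : K' ≃ₐ[K] K', ∀ y : K', y ∈ O' ↔ g y ∈ O') ∧
    (∀ g h : K' ≃ₐ[K] K', (∀ y ∈ O', O'.valuation (g y - y) < 1) →
      (∀ y ∈ O', O'.valuation (h y - y) < 1) → g * h = h * g) ∧
    (∀ g : K' ≃ₐ[K] K', (∀ y ∈ O', O'.valuation (g y - y) < 1) → g ^ e = 1) ∧
    (∀ y ∈ O', ∃ f : Polynomial k, f ≠ 0 ∧ Polynomial.aeval y f ∈ O'.nonunits) ∧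
  ∀ R : Subalgebra k K, R.FG → IsFractionRing R K → R.toSubring ≤ O.toSubring →
    ∀ z : Finset K', (↑z : Set K') ⊆ O' → (∀ g : K' ≃ₐ[K] K', ∀ y ∈ z, g y ∈ z) →
    ∃ t₀ : Finset K', (↑z : Set K') ⊆ modelAbove k R K' t₀ ∧ modelAbove k R K' t₀ ≤ O'.toSubring ∧
      (∀ g : K' ≃ₐ[K] K', ∀ y ∈ modelAbove k R K' t₀, g y ∈ modelAbove k R K' t₀) ∧
      IsRegularLocalRing (locAtCentre (modelAbove k R K' t₀) O')

variable {k}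

/-- **Galois generation by a `T`-separator.**  In a finite Galois extension `K′/K`, if every `g ∈ G` fixing `x`
lies in the subgroup `T`, then every `T`-fixed element is a polynomial in `x` over `K`
(`K′^T ⊆ K′^{Gal(K′/K(x))} = K(x) = K[x]`: Mathlib's Galois correspondence `IsGalois.fixedField_fixingSubgroup`).
[folklore; Mathlib] -/
theorem exists_aeval_eq_of_fixed {K' : Type} [Field K'] [Algebra K K'] [FiniteDimensional K K']
    [IsGalois K K'] (T : Subgroup (K' ≃ₐ[K] K')) (x : K')
    (hx : ∀ g : K' ≃ₐ[K] K', g x = x → g ∈ T) (z : K') (hz : ∀ g ∈ T, g z = z) :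
    ∃ p : K[X], z = Polynomial.aeval x p := by
  have h1 : IntermediateField.fixingSubgroup K⟮x⟯ ≤ T := fun g hg =>
    hx g ((IntermediateField.mem_fixingSubgroup_iff K⟮x⟯ g).mp hg x
      (IntermediateField.mem_adjoin_simple_self K x))
  have h2 : z ∈ IntermediateField.fixedField T := (IntermediateField.mem_fixedField_iff T z).mpr hz
  have h3 : IntermediateField.fixedField T ≤
      IntermediateField.fixedField (IntermediateField.fixingSubgroup K⟮x⟯) := by
    intro y hy
    rw [IntermediateField.mem_fixedField_iff] at hy ⊢
    exact fun f hf => hy f (h1 hf)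
  have h4 : z ∈ (K⟮x⟯).toSubalgebra := by
    have h := h3 h2
    rw [IsGalois.fixedField_fixingSubgroup K⟮x⟯] at h
    exact h
  rw [IntermediateField.adjoin_simple_toSubalgebra_of_isAlgebraic (Algebra.IsAlgebraic.isAlgebraic x),
    Algebra.adjoin_singleton_eq_range_aeval] at h4
  obtain ⟨p, hp⟩ := h4
  exact ⟨p, hp.symm⟩

/-- **Transport to the base** (g26 `TameAbelianQuotientLU3` steps (6)–(7), generic): a model `ι(R)[t] ⊆ O′` of `K′`
with `t ⊆ ι(K)` and regular local ring at the centre of `O′` (`O′ ∩ K = O`) descends to an f.g. model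
`A = R[ι⁻¹ t] ⊆ O` of `K` with `R ⊆ A` and `A_{𝔪_O ∩ A}` regular (`IsLocalization.ringEquivOfRingEquiv`). [folklore] -/
theorem relLU_transport {K' : Type} [Field K'] [Algebra K K'] {O : ValuationSubring K}
    {O' : ValuationSubring K'} (hO'O : O'.comap (algebraMap K K') = O) {R : Subalgebra k K}
    (hRfg : R.FG) (t : Finset K') (ht_sub : (t : Set K') ⊆ Set.range (algebraMap K K' : K →+* K'))
    (hTO : Subring.closure (((R.toSubring.map (algebraMap K K' : K →+* K')) : Set K') ∪ (t : Set K')) ≤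
      O'.toSubring)
    (hTreg : IsRegularLocalRing (locAtCentre (Subring.closure
      (((R.toSubring.map (algebraMap K K' : K →+* K')) : Set K') ∪ (t : Set K'))) O')) :
    ∃ (A : Subalgebra k K) (h : A.toSubring ≤ O.toSubring), R ≤ A ∧ A.FG ∧
      IsRegularLocalRing (Localization.AtPrime
        (Ideal.comap (Subring.inclusion h) (IsLocalRing.maximalIdeal O))) := by
  classical
  have hfinj : Function.Injective (algebraMap K K' : K →+* K') := (algebraMap K K').injective
  have hmemO : ∀ x : K, x ∈ O ↔ algebraMap K K' x ∈ O' := fun x => by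
    rw [← hO'O]
    rfl
  have hvalO : ∀ y : K, O.valuation y < 1 ↔ O'.valuation (algebraMap K K' y) < 1 := fun y => by
    rw [← valuation_comap_lt_one_iff O' (algebraMap K K' : K →+* K') y, hO'O]
  let tK : Finset K := t.preimage (algebraMap K K') (hfinj.injOn)
  have hftK : (algebraMap K K' : K →+* K') '' (tK : Set K) = (t : Set K') := by
    rw [Finset.coe_preimage]
    exact Set.image_preimage_eq_of_subset ht_sub
  obtain ⟨s₀, hs₀⟩ := hRfg
  let A₀ : Subalgebra k K := Algebra.adjoin k ((s₀ : Set K) ∪ (tK : Set K))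
  have hRA₀ : R ≤ A₀ := by
    rw [← hs₀]
    exact Algebra.adjoin_mono Set.subset_union_left
  have hA₀fg : A₀.FG := ⟨s₀ ∪ tK, by rw [Finset.coe_union]⟩
  have hRcl : R.toSubring = Subring.closure (Set.range (algebraMap k K) ∪ (s₀ : Set K)) := by
    rw [← hs₀]
    exact Algebra.adjoin_eq_ring_closure _
  have hA₀cl : A₀.toSubring =
      Subring.closure (Set.range (algebraMap k K) ∪ ((s₀ : Set K) ∪ (tK : Set K))) :=
    Algebra.adjoin_eq_ring_closure _
  have hT : A₀.toSubring.map (algebraMap K K' : K →+* K') =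
      Subring.closure (((R.toSubring.map (algebraMap K K' : K →+* K')) : Set K') ∪ (t : Set K')) := by
    have e1 : ((R.toSubring.map (algebraMap K K' : K →+* K') : Subring K') : Set K') =
        (Subring.closure ((algebraMap K K' : K →+* K') '' (Set.range (algebraMap k K) ∪ (s₀ : Set K))) :
          Set K') := by
      rw [hRcl, RingHom.map_closure]
    rw [hA₀cl, RingHom.map_closure, e1, Subring.closure_union, Subring.closure_eq, ← Subring.closure_union]
    simp only [Set.image_union, hftK, Set.union_assoc]
  have hA₀O : A₀.toSubring ≤ O.toSubring := by
    intro x hx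
    have hfx : algebraMap K K' x ∈ A₀.toSubring.map (algebraMap K K' : K →+* K') :=
      Subring.mem_map.mpr ⟨x, hx, rfl⟩
    rw [hT] at hfx
    exact (hmemO x).mpr (hTO hfx)
  refine ⟨A₀, hA₀O, hRA₀, hA₀fg, ?_⟩
  let g : A₀.toSubring ≃+*
      Subring.closure (((R.toSubring.map (algebraMap K K' : K →+* K')) : Set K') ∪ (t : Set K')) :=
    (A₀.toSubring.equivMapOfInjective (algebraMap K K' : K →+* K') hfinj).trans (RingEquiv.subringCongr hT)
  have hg : ∀ x : A₀.toSubring, ((g x : Subring.closure (((R.toSubring.map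
      (algebraMap K K' : K →+* K')) : Set K') ∪ (t : Set K'))) : K') = algebraMap K K' x := fun _ => rfl
  set P : Ideal A₀.toSubring := Ideal.comap (Subring.inclusion hA₀O) (IsLocalRing.maximalIdeal O) with hP
  set P' := subringCentre (Subring.closure (((R.toSubring.map (algebraMap K K' : K →+* K')) : Set K') ∪
    (t : Set K'))) O' hTO with hP'
  haveI hregP' : IsRegularLocalRing (Localization.AtPrime P') :=
    (isRegularLocalRing_locAtCentre_iff hTO).mp hTreg
  have hPP' : P = P'.comap g.toRingHom := by
    ext x
    simp only [hP, hP', Ideal.mem_comap, RingEquiv.toRingHom_eq_coe, RingHom.coe_coe,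
      mem_subringCentre_iff]
    rw [ValuationSubring.valuation_lt_one_iff, hg]
    exact hvalO x
  have hmap : Submonoid.map g.toRingHom.toMonoidHom P.primeCompl = P'.primeCompl := by
    ext y
    constructor
    · rintro ⟨x, hx, rfl⟩
      change g x ∉ P'
      have hx' : x ∉ P := hx
      rw [hPP', Ideal.mem_comap] at hx'
      exact hx'
    · intro hy
      have hy' : y ∉ P' := hy
      refine ⟨g.symm y, ?_, ?_⟩
      · change g.symm y ∉ P
        rw [hPP', Ideal.mem_comap]
        change ¬ g (g.symm y) ∈ P'
        rw [g.apply_symm_apply]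
        exact hy'
      · change g (g.symm y) = y
        exact g.apply_symm_apply y
  exact IsRegularLocalRing.of_ringEquiv (R := Localization.AtPrime P')
    (IsLocalization.ringEquivOfRingEquiv (Localization.AtPrime P) (Localization.AtPrime P') g hmap).symm

end Law

end Summit.ResolutionOfSingularities.ResolutionOfSingularities.Theorems.TameTwoStoreyLU

end
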